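import Summits.AtomisticToContinuum.FouriersLaw.Theorems.BondHeatUncertaintyBoundedResponseHeatSpreading
import Summits.AtomisticToContinuum.FouriersLaw.Theorems.BondHeatUncertaintyBoundedResponseBlockEnergyVariance
import Summits.AtomisticToContinuum.FouriersLaw.Theorems.BondHeatUncertaintySubdiffusiveBondHeatBathBondReductionVariance
import Summits.AtomisticToContinuum.FouriersLaw.Theorems.BondHeatUncertaintySubdiffusiveBondHeatBathBondReductionDynkin
import Literature.MathematicalPhysics.KineticTheory.LangevinChainEnergyIdentity
import Literature.MathematicalPhysics.KineticTheory.LangevinChainScalingLimit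
import HarnessLib

/-!
# BondHeatUncertainty / BoundedResponse — «TotalBondComparison»: the fixed-`N` telescoping (TBC) PROVED (lens-1 g105, NODE 105)

Blocker 11071 `BoundedResponse`.  NODE 104 («HeatSpreading», landed as `…BoundedResponseHeatSpreading{A,B,}`) typed the Einstein–Helfand
ladder of the TOTAL current `J = ∑_i j_i` and left, among its graded pieces, the fixed-`N` comparison

  (TBC) `TotalBondComparison`:  `V_N(t) ≤ 2(N−1)²·V_N(b,t) + C·N³`  (every `N`, every bond `b` with `b+1<N`, every `t ≥ 0`),

`V_N(t) = heatSpread` the second moment of `∫₀ᵗ J` and `V_N(b,t) = gibbsBondHeatVar` that of the single bond heat `∫₀ᵗ j_b` along the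
stationary equilibrium dynamics (`μ_T`, both baths at `T`), tagged WEAKER · fixed-`N` · ATTACKABLE·M.  THIS FILE PROVES IT
(`totalBondComparison_holds`, `C = 32·C_W` with `C_W` the constant of the PROVED static input (W) `ExtensiveBlockEnergyVariance`), and with it
the seams of NODE 104 become statements about the route's two open cruxes alone:

  ★ `(S) ⟹ (HSᴾ_3)` · ★ `(S) ∧ (TCᶜ_3) ⟹ 11071` · ★ `(S) ⟹ (11071 ⟺ (TCᶜ_3))`   (`§5`; (S) = `SubdiffusiveBondHeat`, item 9120),

i.e. GIVEN THE (S) BRANCH, THE BLOCKER IS EXACTLY THE GREEN–KUBO TAIL CEILING (TCᶜ_3) `Tr_N(cN²) ≤ C·N³` — a phonon-compatible statement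
already proved NECESSARY for 11071 (`gkTailCeiling_three_of_boundedResponse`).

THE PROOF (deterministic telescoping, then one squaring).  §1 site energies `e_k = p_k²/2 + U(q_k) + ½V(bond left of k) + ½V(bond right of k)`
with `E_{≤b} = ∑_{k≤b} e_k` (`blockEnergyLeft_eq_sum_splitSiteEnergy`: the symmetric half-bond split IS the convention of `blockEnergyLeft`).
§2 the PATHWISE interior balance `e_k(Φ_t) = e_k(x) + ∫₀ᵗ (j_{k−1} − j_k)(Φ_s) ds` for the chain flow driven by ANY continuous forcing
vanishing at site `k` (integral equation of `chainFlow` + the fundamental theorem of calculus; no Itô term since interior sites carry no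
noise).  §3 along the constructed solution map `z_s = solMap s x w` (bath noise `chainNoise` vanishes in the interior): the block heats
telescope, `∫₀ᵗ j_b(z) + ΔE_{≤b}` is independent of `b`, whence the TOTAL-HEAT IDENTITY
`∫₀ᵗ J(z) = (N−1)·∫₀ᵗ j_b(z) + F_b(z_t) − F_b(x)`, `F_b = ∑_{i+1<N}(E_{≤b} − E_{≤i})` (`j_{N−1} ≡ 0`), for EVERY `x` and EVERY pair of
raw paths `w`.  §4 centre `F_b` at its Gibbs means (increments unchanged), square, split `A² ≤ 2(N−1)²B² + 4F̃(z_t)² + 4F̃(x)²`, integrate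
against `μ_T ⊗ W`: `E[A²] = V_N(t)` (`heatSpread_eq_integral_sq`), `E[B²] = V_N(b,t)` (`pinnedChain_integral_sq_intervalIntegral_of_invariant`
+ kernel Gibbs invariance), `E[F̃(z_t)²] = E[F̃(x)²] = ∫F̃² dμ_T` (one-time law `pinnedChain_integrable_sq_solMap_of_invariant`), and the static
cost `∫F̃_b² dμ_T ≤ N·∑_i 2(Var E_{≤b} + Var E_{≤i}) ≤ 4C_W N³` (Cauchy–Schwarz over the `N−1` summands, (W)).  §5 the corollaries through the
NODE-104 doors.  [folklore] throughout (energy continuity of the harmonic/anharmonic chain, Helfand-moment bookkeeping); 0 sorry · standard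
axioms · tree imports only · no `set_option` / `instance` / notation.
-/

noncomputable section

open MeasureTheory ProbabilityTheory Filter Topology Set Function
open scoped NNReal ENNReal
open Literature.MathematicalPhysics.KineticTheory.HeatConduction
open Literature.MathematicalPhysics.KineticTheory OscillatorChain
open Literature.Probability.Process
open Summit.AtomisticToContinuum.FouriersLaw.Theorems.SubdiffusiveBondHeat

namespace Summit.AtomisticToContinuum.FouriersLaw.Theorems.BoundedResponse.HeatSpreading

open Summit.AtomisticToContinuum.FouriersLaw.Theorems.BoundedResponse.TransientContact
  (gibbsBondHeatVar gibbsBondCorr blockEnergyLeft blockEnergyLeftVar ExtensiveBlockEnergyVariance)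
open Summit.AtomisticToContinuum.FouriersLaw.Theorems.BoundedResponse.ParityFloor (extensiveBlockEnergyVariance_holds)
open Summit.AtomisticToContinuum.FouriersLaw.Theses.BondHeatUncertainty (BoundedResponse SubdiffusiveBondHeat)

variable {N : ℕ}

/-! ## §1 Site energies with the symmetric bond split; statics -/

/-- The SITE ENERGY with the symmetric bond split: `e_k = p_k²/2 + U(q_k) + ½V(q_k − q_{k−1}) + ½V(q_{k+1} − q_k)`
(half of every bond touching `k`; the missing neighbours at the two ends contribute nothing), written as a double
bond sum like `OscillatorChain.hamiltonian`. [Bonetto–Lebowitz–Rey-Bellet 2000, §5.2 eq. (23)] -/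
def splitSiteEnergy (P : OscillatorChain) (N : ℕ) (k : Fin N) (x : PhaseSpace N) : ℝ :=
  x.2 k ^ 2 / 2 + P.U (x.1 k) +
    ∑ i : Fin N, ∑ j : Fin N,
      if j.val = i.val + 1 then
        ((if j = k then P.V (x.1 j - x.1 i) / 2 else 0) + (if i = k then P.V (x.1 j - x.1 i) / 2 else 0))
      else 0

/-- **`E_{≤b} = ∑_{k ≤ b} e_k`**: the cell's left block energy (`TransientContact.blockEnergyLeft`, half of the
boundary bond `(b, b+1)` included) is the sum of the symmetric-split site energies of the sites `0..b`, for EVERY `b`.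
[formal bookkeeping] -/
theorem blockEnergyLeft_eq_sum_splitSiteEnergy (P : OscillatorChain) (N b : ℕ) (x : PhaseSpace N) :
    blockEnergyLeft P N b x = ∑ k : Fin N, if k.val ≤ b then splitSiteEnergy P N k x else 0 := by
  unfold blockEnergyLeft splitSiteEnergy
  -- split the right-hand side into the on-site part and the bond part
  have hsplit : (∑ k : Fin N, if k.val ≤ b then
      (x.2 k ^ 2 / 2 + P.U (x.1 k) +
        ∑ i : Fin N, ∑ j : Fin N,
          if j.val = i.val + 1 then
            ((if j = k then P.V (x.1 j - x.1 i) / 2 else 0) + (if i = k then P.V (x.1 j - x.1 i) / 2 else 0))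
          else 0) else 0) =
      (∑ k : Fin N, if k.val ≤ b then x.2 k ^ 2 / 2 + P.U (x.1 k) else 0) +
        ∑ k : Fin N, ∑ i : Fin N, ∑ j : Fin N,
          if k.val ≤ b then
            (if j.val = i.val + 1 then
              ((if j = k then P.V (x.1 j - x.1 i) / 2 else 0) + (if i = k then P.V (x.1 j - x.1 i) / 2 else 0))
            else 0) else 0 := by
    rw [← Finset.sum_add_distrib]
    refine Finset.sum_congr rfl fun k _ => ?_
    by_cases hk : k.val ≤ b
    · simp only [hk, if_true]
    · simp [hk]
  rw [hsplit]
  congr 1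
  -- the bond part: move the `k`-sum inside and evaluate it
  symm
  rw [Finset.sum_comm]
  refine Finset.sum_congr rfl fun i _ => ?_
  rw [Finset.sum_comm]
  refine Finset.sum_congr rfl fun j _ => ?_
  by_cases hji : j.val = i.val + 1
  · simp_rw [if_pos hji]
    -- `∑_k [k ≤ b] ([j = k] V/2 + [i = k] V/2) = [j ≤ b] V/2 + [i ≤ b] V/2`
    have h1 : ∀ k : Fin N, (if k.val ≤ b then
        ((if j = k then P.V (x.1 j - x.1 i) / 2 else 0) + (if i = k then P.V (x.1 j - x.1 i) / 2 else 0))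
          else (0 : ℝ)) =
        (if j = k then (if k.val ≤ b then P.V (x.1 j - x.1 i) / 2 else 0) else 0) +
          (if i = k then (if k.val ≤ b then P.V (x.1 j - x.1 i) / 2 else 0) else 0) := by
      intro k
      split_ifs <;> ring
    rw [Finset.sum_congr rfl fun k _ => h1 k, Finset.sum_add_distrib, Finset.sum_ite_eq, Finset.sum_ite_eq]
    simp only [Finset.mem_univ, if_true]
    by_cases hjb : j.val ≤ b
    · have hib : i.val ≤ b := by omega
      rw [if_pos hjb, if_pos hib, if_pos hjb]
      ring
    · rw [if_neg hjb, if_neg hjb, zero_add]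
      by_cases hib : i.val = b
      · rw [if_pos hib.le, if_pos hib]
      · have hib' : ¬ i.val ≤ b := by omega
        rw [if_neg hib', if_neg hib]
  · simp [hji]

/-- `E_{≤b+1} − E_{≤b} = e_{b+1}` (whenever `b + 1` is a site). [formal bookkeeping] -/
theorem blockEnergyLeft_succ_sub (P : OscillatorChain) {N b : ℕ} (hb : b + 1 < N) (x : PhaseSpace N) :
    blockEnergyLeft P N (b + 1) x - blockEnergyLeft P N b x = splitSiteEnergy P N ⟨b + 1, hb⟩ x := by
  rw [blockEnergyLeft_eq_sum_splitSiteEnergy, blockEnergyLeft_eq_sum_splitSiteEnergy, ← Finset.sum_sub_distrib]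
  have h1 : ∀ k : Fin N, ((if k.val ≤ b + 1 then splitSiteEnergy P N k x else 0) -
      (if k.val ≤ b then splitSiteEnergy P N k x else 0)) =
      if k = ⟨b + 1, hb⟩ then splitSiteEnergy P N k x else 0 := by
    intro k
    by_cases hk : k = ⟨b + 1, hb⟩
    · subst hk
      simp
    · have hk' : k.val ≠ b + 1 := fun h => hk (Fin.ext h)
      by_cases hkb : k.val ≤ b
      · have : k.val ≤ b + 1 := by omega
        simp [hkb, this, hk]
      · have : ¬ k.val ≤ b + 1 := by omega
        simp [hkb, this, hk]
  simp_rw [h1]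
  rw [Finset.sum_ite_eq']
  simp

/-- Closed form of the site energy at an INTERIOR site `k` with neighbours `km = k − 1`, `kp = k + 1`:
`e_k = p_k²/2 + U(q_k) + ½V(q_k − q_{k−1}) + ½V(q_{k+1} − q_k)`. [formal bookkeeping] -/
theorem splitSiteEnergy_eq_interior (P : OscillatorChain) {km k kp : Fin N} (hkm : km.val + 1 = k.val)
    (hkp : kp.val = k.val + 1) (x : PhaseSpace N) :
    splitSiteEnergy P N k x = x.2 k ^ 2 / 2 + P.U (x.1 k) + P.V (x.1 k - x.1 km) / 2 + P.V (x.1 kp - x.1 k) / 2 := by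
  unfold splitSiteEnergy
  rw [add_assoc (x.2 k ^ 2 / 2 + P.U (x.1 k))]
  congr 1
  -- split the double sum into the `[j = k]` part and the `[i = k]` part
  have hsplit : ∀ i j : Fin N, (if j.val = i.val + 1 then
      ((if j = k then P.V (x.1 j - x.1 i) / 2 else 0) + (if i = k then P.V (x.1 j - x.1 i) / 2 else 0)) else (0 : ℝ)) =
      (if j.val = i.val + 1 ∧ j = k then P.V (x.1 j - x.1 i) / 2 else 0) +
        (if j.val = i.val + 1 ∧ i = k then P.V (x.1 j - x.1 i) / 2 else 0) := by
    intro i j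
    by_cases h1 : j.val = i.val + 1
    · by_cases h2 : j = k <;> by_cases h3 : i = k <;> simp [h1, h2, h3]
    · simp [h1]
  simp_rw [hsplit, Finset.sum_add_distrib]
  congr 1
  · -- `∑_i ∑_j [j = i+1 ∧ j = k] V(q_j - q_i)/2 = V(q_k - q_{km})/2`
    rw [Finset.sum_comm]
    rw [Finset.sum_eq_single k (fun j _ hj => by simp [hj]) (by simp)]
    rw [Finset.sum_eq_single km]
    · simp [show k.val = km.val + 1 by omega]
    · intro i _ hi
      rw [if_neg]
      rintro ⟨h1, -⟩
      apply hi
      exact Fin.ext (by omega)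
    · simp
  · -- `∑_i ∑_j [j = i+1 ∧ i = k] V(q_j - q_i)/2 = V(q_{kp} - q_k)/2`
    rw [Finset.sum_eq_single k (fun i _ hi => by simp [hi]) (by simp)]
    rw [Finset.sum_eq_single kp]
    · simp [hkp]
    · intro j _ hj
      rw [if_neg]
      rintro ⟨h1, -⟩
      apply hj
      exact Fin.ext (by omega)
    · simp

/-! ## §2 The pathwise energy balance at an interior site

Closed forms at an interior site `k` (neighbours `km = k − 1`, `kp = k + 1`) and the site-`k` analogue of the
bath-site balance `SubdiffusiveBondHeat.pinnedChain_siteEnergy_chainFlow_eq_aux`: along the flow `z = chainFlow x η`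
driven by a continuous momentum-noise path `η` that does NOT touch site `k` (`η_k ≡ 0`, as for the bath noise at
every interior site), `e_k(z t) = e_k(x) + ∫₀ᵗ (j_{k−1} − j_k)(z s) ds` — no dissipation and no noise work. -/

section Pathwise

variable (P : OscillatorChain) {km k kp : Fin N}

/-- `∂_{q_k} H = U'(q_k) + V'(q_k − q_{k−1}) − V'(q_{k+1} − q_k)` at an interior site (closed form of
`OscillatorChain.dPotential`: exactly the two bonds `(k−1,k)`, `(k,k+1)` touch site `k`). [folklore] -/
private theorem dPotential_interior_aux (hkm : km.val + 1 = k.val) (hkp : kp.val = k.val + 1) (q : Fin N → ℝ) :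
    P.dPotential N k q = deriv P.U (q k) + deriv P.V (q k - q km) - deriv P.V (q kp - q k) := by
  unfold OscillatorChain.dPotential
  rw [add_sub_assoc]
  congr 1
  have h1 : ∀ k' l : Fin N, (if l.val = k'.val + 1 then
      deriv P.V (q l - q k') * ((if l = k then 1 else 0) - (if k' = k then 1 else 0)) else (0 : ℝ)) =
      (if l = k then (if l.val = k'.val + 1 then deriv P.V (q l - q k') else 0) else 0) -
        (if k' = k then (if l.val = k'.val + 1 then deriv P.V (q l - q k') else 0) else 0) := by
    intro k' l
    split_ifs <;> ring
  have h2 : ∀ k' : Fin N, (∑ l : Fin N, if l.val = k'.val + 1 then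
      deriv P.V (q l - q k') * ((if l = k then 1 else 0) - (if k' = k then 1 else 0)) else (0 : ℝ)) =
      (if k.val = k'.val + 1 then deriv P.V (q k - q k') else 0) -
        (if k' = k then (∑ l : Fin N, if l.val = k'.val + 1 then deriv P.V (q l - q k') else 0) else 0) := by
    intro k'
    rw [Finset.sum_congr rfl fun l _ => h1 k' l, Finset.sum_sub_distrib, Finset.sum_ite_eq']
    simp only [Finset.mem_univ, if_true]
    congr 1
    by_cases hk' : k' = k
    · simp only [hk', if_true]
    · simp only [hk', if_false, Finset.sum_const_zero]
  rw [Finset.sum_congr rfl fun k' _ => h2 k', Finset.sum_sub_distrib, Finset.sum_ite_eq']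
  simp only [Finset.mem_univ, if_true]
  congr 1
  · -- `∑_{k'} [k = k'+1] V'(q_k − q_{k'}) = V'(q_k − q_{km})`
    rw [Finset.sum_eq_single km]
    · rw [if_pos hkm.symm]
    · intro k' _ hk'
      rw [if_neg]
      intro h
      exact hk' (Fin.ext (by omega))
    · simp
  · -- `∑_l [l = k+1] V'(q_l − q_k) = V'(q_{kp} − q_k)`
    rw [Finset.sum_eq_single kp]
    · rw [if_pos hkp]
    · intro l _ hl
      rw [if_neg]
      intro h
      exact hl (Fin.ext (by omega))
    · simp

/-- The bond current through the bond `(i0, i0+1)`: `j_{i0} = −½ (p_{i0} + p_{i0+1}) V'(q_{i0+1} − q_{i0})`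
(closed form of `OscillatorChain.bondCurrent N i0` when `i1 = i0 + 1` is a site; private copy of
`SubdiffusiveBondHeat.bondCurrent_siteZero_aux`). [folklore] -/
private theorem bondCurrent_succ_aux {i0 i1 : Fin N} (hi : i1.val = i0.val + 1) (x : PhaseSpace N) :
    P.bondCurrent N i0 x = -((x.2 i0 + x.2 i1) / 2 * deriv P.V (x.1 i1 - x.1 i0)) := by
  unfold OscillatorChain.bondCurrent
  rw [Fintype.sum_eq_single i1]
  · simp [hi]
  · intro j hj
    have hj1 : ¬ (j.val = i0.val + 1) := by
      intro h; apply hj; exact Fin.ext (by omega)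
    simp only [hj1, if_false]

/-- **The pathwise energy balance at an interior site** (pinned chain, `ω₂ > 0`, `lam, β, γ ≥ 0`; sites
`km, k, kp` with values `k−1, k, k+1`): along the flow `z = chainFlow x η` driven by a continuous
momentum-noise path `η` with `η_k ≡ 0`, for `t ≥ 0`,
`e_k(z t) = e_k(x) + ∫₀ᵗ (j_{k−1}(z s) − j_k(z s)) ds`.
Proof (as at the bath site): `y = z − (0, η)` is `C¹` with `y' = Y(z)` and agrees with `z` in every coordinate
entering `e_k`; the chain rule with the closed forms of `∂_{q_k}H` and `j_{k−1}, j_k` and `bathWeight k = 0`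
gives `(e_k ∘ y)' = j_{k−1}(z) − j_k(z)`; integrate. [folklore] -/
theorem pinnedChain_splitSiteEnergy_interior_chainFlow_eq {ω₂ lam β γ : ℝ} (hω : 0 < ω₂) (hl : 0 ≤ lam)
    (hβ : 0 ≤ β) (hγ : 0 ≤ γ) (hkm : km.val + 1 = k.val) (hkp : kp.val = k.val + 1)
    (x : PhaseSpace N) {η : ℝ → Fin N → ℝ} (hη : Continuous η) (hηk : ∀ s, η s k = 0) {t : ℝ} (ht : 0 ≤ t) :
    splitSiteEnergy (pinnedChain ω₂ lam β γ) N k ((pinnedChain ω₂ lam β γ).chainFlow N x η t) =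
      splitSiteEnergy (pinnedChain ω₂ lam β γ) N k x +
        ∫ s in (0 : ℝ)..t, ((pinnedChain ω₂ lam β γ).bondCurrent N km ((pinnedChain ω₂ lam β γ).chainFlow N x η s) -
          (pinnedChain ω₂ lam β γ).bondCurrent N k ((pinnedChain ω₂ lam β γ).chainFlow N x η s)) := by
  have hk0 : k.val ≠ 0 := by omega
  have hkN : k.val ≠ N - 1 := by have := kp.isLt; omega
  rw [splitSiteEnergy_eq_interior _ hkm hkp, splitSiteEnergy_eq_interior _ hkm hkp]
  set P := pinnedChain ω₂ lam β γ with hP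
  set Y := P.drift N with hYdef
  set z := P.chainFlow N x η with hzdef
  have hU : Differentiable ℝ P.U := (pinnedChain_contDiff_U ω₂ lam β γ (n := 1)).differentiable one_ne_zero
  have hV : Differentiable ℝ P.V := (pinnedChain_contDiff_V ω₂ lam β γ (n := 1)).differentiable one_ne_zero
  have hUc : Continuous (deriv P.U) := (pinnedChain_contDiff_U ω₂ lam β γ (n := 1)).continuous_deriv le_rfl
  have hVc : Continuous (deriv P.V) := (pinnedChain_contDiff_V ω₂ lam β γ (n := 1)).continuous_deriv le_rfl
  have hYc : Continuous Y := (pinnedChain_contDiff_drift ω₂ lam β γ N (n := 0)).continuous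
  have hzc : Continuous z := pinnedChain_continuous_chainFlow hω hl hβ hγ N x hη
  have hz_eq : ∀ s ∈ Icc 0 t, z s = forcing x η s + ∫ r in (0 : ℝ)..s, Y (z r) :=
    pinnedChain_isIntegralSolutionOn_chainFlow hω hl hβ hγ N x hη t
  -- `y(t) = x + ∫₀ᵗ Y(z)`, `y' = Y(z)`, `y = z - (0, η)` on `[0, t]`
  set y : ℝ → PhaseSpace N := fun s => x + ∫ r in (0 : ℝ)..s, Y (z r) with hydef
  have hy_deriv : ∀ s, HasDerivAt y (Y (z s)) s := fun s => by
    have h1 : HasDerivAt (fun u => ∫ r in (0 : ℝ)..u, Y (z r)) (Y (z s)) s :=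
      ((hYc.comp hzc).integral_hasStrictDerivAt 0 s).hasDerivAt
    exact h1.const_add x
  have hyc : Continuous y := continuous_iff_continuousAt.2 fun s => (hy_deriv s).continuousAt
  have hy_eq : ∀ s ∈ Icc 0 t, y s = z s - ((0 : Fin N → ℝ), η s) := fun s hs => by
    rw [hz_eq s hs]
    simp only [hydef, forcing]
    abel
  have hy1 : ∀ s ∈ Icc 0 t, (y s).1 = (z s).1 := fun s hs => by
    rw [hy_eq s hs]; simp
  have hy2 : ∀ s ∈ Icc 0 t, (y s).2 k = (z s).2 k := fun s hs => by
    rw [hy_eq s hs]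
    simp [hηk s]
  have hy0 : y 0 = x := by simp [hydef]
  -- derivatives of the four coordinates of `y` entering `e_k`
  have hfst : ∀ s, HasDerivAt (fun s => (y s).1) ((Y (z s)).1) s := fun s =>
    (ContinuousLinearMap.fst ℝ (Fin N → ℝ) (Fin N → ℝ)).hasFDerivAt.comp_hasDerivAt s (hy_deriv s)
  have hsnd : ∀ s, HasDerivAt (fun s => (y s).2) ((Y (z s)).2) s := fun s =>
    (ContinuousLinearMap.snd ℝ (Fin N → ℝ) (Fin N → ℝ)).hasFDerivAt.comp_hasDerivAt s (hy_deriv s)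
  have ha : ∀ s, HasDerivAt (fun s => (y s).2 k) ((Y (z s)).2 k) s := fun s => hasDerivAt_pi.1 (hsnd s) k
  have hb : ∀ s, HasDerivAt (fun s => (y s).1 k) ((Y (z s)).1 k) s := fun s => hasDerivAt_pi.1 (hfst s) k
  have hc : ∀ s, HasDerivAt (fun s => (y s).1 km) ((Y (z s)).1 km) s := fun s => hasDerivAt_pi.1 (hfst s) km
  have hd : ∀ s, HasDerivAt (fun s => (y s).1 kp) ((Y (z s)).1 kp) s := fun s => hasDerivAt_pi.1 (hfst s) kp
  -- the derivative of `e_k ∘ y`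
  set φ' : ℝ → ℝ := fun s => (y s).2 k * (Y (z s)).2 k + deriv P.U ((y s).1 k) * (Y (z s)).1 k +
    deriv P.V ((y s).1 k - (y s).1 km) * ((Y (z s)).1 k - (Y (z s)).1 km) / 2 +
    deriv P.V ((y s).1 kp - (y s).1 k) * ((Y (z s)).1 kp - (Y (z s)).1 k) / 2 with hφ'
  have hφ : ∀ s, HasDerivAt (fun s => (y s).2 k ^ 2 / 2 + P.U ((y s).1 k) + P.V ((y s).1 k - (y s).1 km) / 2 +
      P.V ((y s).1 kp - (y s).1 k) / 2) (φ' s) s := by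
    intro s
    have h1 := ((ha s).pow 2).div_const 2
    have h2 : HasDerivAt (fun s => P.U ((y s).1 k)) (deriv P.U ((y s).1 k) * (Y (z s)).1 k) s :=
      (hU _).hasDerivAt.comp s (hb s)
    have h3 : HasDerivAt (fun s => P.V ((y s).1 k - (y s).1 km) / 2)
        (deriv P.V ((y s).1 k - (y s).1 km) * ((Y (z s)).1 k - (Y (z s)).1 km) / 2) s :=
      ((hV _).hasDerivAt.comp s ((hb s).sub (hc s))).div_const 2
    have h4 : HasDerivAt (fun s => P.V ((y s).1 kp - (y s).1 k) / 2)
        (deriv P.V ((y s).1 kp - (y s).1 k) * ((Y (z s)).1 kp - (Y (z s)).1 k) / 2) s :=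
      ((hV _).hasDerivAt.comp s ((hd s).sub (hb s))).div_const 2
    refine (((h1.add h2).add h3).add h4).congr_deriv ?_
    simp only [hφ']
    push_cast
    ring
  have hφ'c : Continuous φ' := by
    have hy1c : Continuous fun s => (y s).1 := continuous_fst.comp hyc
    have hy2c : Continuous fun s => (y s).2 := continuous_snd.comp hyc
    have hY1c : Continuous fun s => (Y (z s)).1 := continuous_fst.comp (hYc.comp hzc)
    have hY2c : Continuous fun s => (Y (z s)).2 := continuous_snd.comp (hYc.comp hzc)
    have h_a : Continuous fun s => (y s).2 k := (continuous_apply k).comp hy2c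
    have h_b : Continuous fun s => (y s).1 k := (continuous_apply k).comp hy1c
    have h_c : Continuous fun s => (y s).1 km := (continuous_apply km).comp hy1c
    have h_d : Continuous fun s => (y s).1 kp := (continuous_apply kp).comp hy1c
    have h_a' : Continuous fun s => (Y (z s)).2 k := (continuous_apply k).comp hY2c
    have h_b' : Continuous fun s => (Y (z s)).1 k := (continuous_apply k).comp hY1c
    have h_c' : Continuous fun s => (Y (z s)).1 km := (continuous_apply km).comp hY1c
    have h_d' : Continuous fun s => (Y (z s)).1 kp := (continuous_apply kp).comp hY1c
    simp only [hφ']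
    exact (((h_a.mul h_a').add ((hUc.comp h_b).mul h_b')).add
      (((hVc.comp (h_b.sub h_c)).mul (h_b'.sub h_c')).div_const 2)).add
      (((hVc.comp (h_d.sub h_b)).mul (h_d'.sub h_b')).div_const 2)
  have hFTC : ∫ s in (0 : ℝ)..t, φ' s =
      ((y t).2 k ^ 2 / 2 + P.U ((y t).1 k) + P.V ((y t).1 k - (y t).1 km) / 2 + P.V ((y t).1 kp - (y t).1 k) / 2) -
        (x.2 k ^ 2 / 2 + P.U (x.1 k) + P.V (x.1 k - x.1 km) / 2 + P.V (x.1 kp - x.1 k) / 2) := by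
    rw [intervalIntegral.integral_eq_sub_of_hasDerivAt (fun s _ => hφ s) (hφ'c.intervalIntegrable _ _), hy0]
  -- the integrand on `[0, t]`: `(e_k ∘ y)' = j_{k-1}(z) - j_k(z)` (no bath at site `k`)
  have hbw : bathWeight N k = 0 := by
    unfold bathWeight
    rw [if_neg hk0, if_neg hkN]; ring
  have hintegrand : ∀ s ∈ uIcc 0 t, φ' s = P.bondCurrent N km (z s) - P.bondCurrent N k (z s) := by
    intro s hs
    rw [uIcc_of_le ht] at hs
    have hY1 : ∀ i, (Y (z s)).1 i = (z s).2 i := fun i => rfl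
    have hY2 : (Y (z s)).2 k =
        -(deriv P.U ((z s).1 k) + deriv P.V ((z s).1 k - (z s).1 km) - deriv P.V ((z s).1 kp - (z s).1 k)) := by
      show -partialQ k (P.hamiltonian N) (z s) - P.γ * bathWeight N k * (z s).2 k = _
      rw [P.partialQ_hamiltonian_eq_dPotential hU hV, dPotential_interior_aux P hkm hkp, hbw]
      ring
    simp only [hφ', hy1 s hs, hy2 s hs, hY1, bondCurrent_succ_aux P (i0 := km) (i1 := k) (by omega) (z s),
      bondCurrent_succ_aux P (i0 := k) (i1 := kp) hkp (z s)]
    rw [hY2]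
    ring
  have hInt : ∫ s in (0 : ℝ)..t, φ' s =
      ∫ s in (0 : ℝ)..t, (P.bondCurrent N km (z s) - P.bondCurrent N k (z s)) :=
    intervalIntegral.integral_congr hintegrand
  -- `e_k(z t) = e_k(y t)`
  have hzt1 : (z t).1 = (y t).1 := (hy1 t ⟨ht, le_rfl⟩).symm
  have hzt2 : (z t).2 k = (y t).2 k := (hy2 t ⟨ht, le_rfl⟩).symm
  rw [hzt1, hzt2, ← hInt, hFTC]
  ring

end Pathwise

end Summit.AtomisticToContinuum.FouriersLaw.Theorems.BoundedResponse.HeatSpreading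

end
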